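import Summits.MatrixMultiplication.OmegaCensus.SmallFormats.MatMul22nDoubleCellKill
import HarnessLib

/-!
# ω-census family (a): the L-SHAPE KILL — an admissible (kill vector, kill covector) pair deflates three named terms (any field)

Cell `pub-omega` (unit `pub-omega-tensor`, gen 40), topic `Summits/MatrixMultiplication/OmegaCensus` (sub-folder
`SmallFormats`). Framing (verbatim): lottery ticket; floor = certified bounds/negative ranges. HONEST FRAMING: M1-LEAN-BLUEPRINT F2 (memo DEFLATION-g40 §3):
given two terms `t₁, t₂` of a row whose Y-form rows are multiples of one vector `c⋆` (the row's kill vector, `AllOnesRowTypes.row_structure`) and a term `s`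
of a column whose output rows are multiples of one covector `n⋆` (the column's kill covector, `AllOnesColTypes.col_structure`) with `n⋆ · c⋆ ≠ 0`, the
deflation `Deflation.exists_shorter_of_pair` removes `{t₁, t₂, s}`: a computation of `⟨2,2,n⟩` on `|ι| − 3` indices with the original X-forms outside the
L-shape (`LShapeKill.exists_deflation`). Plus the 2D admissibility lemma `pairing_ne_zero_of_lines` (`x ᵥ* P ≠ 0`, `P yᵥ = 0`, `y ∦ yᵥ` ⇒ `(x ᵥ* P) · y ≠ 0`)
and its cheap-plane form. Nothing here is a bound on `ω`.
-/

namespace Summit.MatrixMultiplication.OmegaCensus.SmallFormats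

open Finset Module Matrix
open Literature.Computability.AlgebraicComplexity
open Summit.MatrixMultiplication.OmegaCensus.RankOnePlaneCapGeneral

namespace LShapeKill

variable {k : Type*} [Field k] {n : ℕ} {ι : Type*} [Fintype ι]

omit [Fintype ι] in
/-- **2D admissibility.** If `u := x ᵥ* P ≠ 0`, `P *ᵥ yᵥ = 0` with `yᵥ ≠ 0`, and `y` is not parallel to `yᵥ`, then `u ⬝ᵥ y ≠ 0`. -/
theorem pairing_ne_zero_of_lines (P : Matrix (Fin 2) (Fin 2) k) (x y yv : Fin 2 → k) (hx : Matrix.vecMul x P ≠ 0)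
    (hyv : Matrix.mulVec P yv = 0) (hyv0 : yv ≠ 0) (hny : y 0 * yv 1 - y 1 * yv 0 ≠ 0) : Matrix.vecMul x P ⬝ᵥ y ≠ 0 := by
  intro h0
  have h1 : Matrix.vecMul x P ⬝ᵥ yv = 0 := by rw [← Matrix.dotProduct_mulVec, hyv, dotProduct_zero]
  -- y and yv are both orthogonal to the non-zero u, hence parallel
  obtain ⟨a₁, a₂, hne, hrel⟩ := GramNondeg.exists_combo_of_perp (Matrix.vecMul x P) y yv hx
    (by rw [dotProduct_comm]; exact h0) (by rw [dotProduct_comm]; exact h1)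
  have e0 := hrel 0
  have e1 := hrel 1
  rcases hne with ha | ha
  · apply hny
    have : y 0 = -(a₂ / a₁) * yv 0 := by field_simp; linear_combination e0
    have h' : y 1 = -(a₂ / a₁) * yv 1 := by field_simp; linear_combination e1
    rw [this, h']; ring
  · apply hyv0
    -- from a₂ ≠ 0: yv = -(a₁/a₂) y, and then the cross product condition forces... use both relations directly
    have f0 : yv 0 = -(a₁ / a₂) * y 0 := by field_simp; linear_combination e0
    have f1 : yv 1 = -(a₁ / a₂) * y 1 := by field_simp; linear_combination e1
    exfalso; apply hny; rw [f0, f1]; ring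

omit [Fintype ι] in
/-- The cheap-plane form: `(∑ x l • c l) ⬝ᵥ (∑ y m • b m) = (x ᵥ* P) ⬝ᵥ y` with `P l m = c l ⬝ᵥ b m`. -/
theorem combo_dot_combo (c b : Fin 2 → (Fin n → k)) (x y : Fin 2 → k) :
    (∑ l, x l • c l) ⬝ᵥ (∑ m, y m • b m) = Matrix.vecMul x (Matrix.of fun l m => c l ⬝ᵥ b m) ⬝ᵥ y := by
  rw [dotProduct_sum, dotProduct]
  refine Finset.sum_congr rfl fun m _ => ?_
  rw [dotProduct_smul, smul_eq_mul, GramNondeg.combo_dotProduct_eq_vecMul, mul_comm]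

/-- **The L-shape kill.** Terms `t₁ ≠ t₂` with Y-form rows on the line `c⋆` and a third term `s` with output rows on the line `n⋆`, `n⋆ ⬝ᵥ c⋆ ≠ 0`: a
computation of `⟨2,2,n⟩` on `|ι| − #{t₁,t₂,s}` indices carrying the original X-forms outside `{t₁, t₂, s}`. -/
theorem exists_deflation [DecidableEq ι] (β : BilinComp (mulBilin k 2 2 (n + 1)) ι) (cstar nstar : Fin (n + 1) → k)
    (hadm : nstar ⬝ᵥ cstar ≠ 0) (t₁ t₂ s : ι)
    (h₁ : ∃ η : Fin 2 → k, ∀ q : Fin 2, (fun j => β.g t₁ (Matrix.single q j (1 : k))) = η q • cstar)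
    (h₂ : ∃ η : Fin 2 → k, ∀ q : Fin 2, (fun j => β.g t₂ (Matrix.single q j (1 : k))) = η q • cstar)
    (hs : ∃ ω : Fin 2 → k, ∀ q : Fin 2, β.w s q = ω q • nstar) :
    ∃ (β' : BilinComp (mulBilin k 2 2 n) (Fin (Fintype.card ι - ({t₁, t₂, s} : Finset ι).card)))
      (e : Fin (Fintype.card ι - ({t₁, t₂, s} : Finset ι).card) → ι),
      Function.Injective e ∧ (∀ a, e a ∉ ({t₁, t₂, s} : Finset ι)) ∧ ∀ a, β'.f a = β.f (e a) := by
  classical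
  have hG : ∀ t (η : Fin 2 → k), (∀ q : Fin 2, (fun j => β.g t (Matrix.single q j (1 : k))) = η q • cstar) →
      ∀ Y, β.g t Y = ∑ q, ∑ j, η q * cstar j * Y q j := by
    intro t η hη Y
    rw [DoubleCellKill.g_eq_sum_rows]
    refine Finset.sum_congr rfl fun q _ => Finset.sum_congr rfl fun j _ => ?_
    have := congrFun (hη q) j
    simp only [Pi.smul_apply, smul_eq_mul] at this
    beta_reduce
    rw [this]
  obtain ⟨η₁, hη₁⟩ := h₁
  obtain ⟨η₂, hη₂⟩ := h₂
  obtain ⟨ω, hω⟩ := hs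
  obtain ⟨β', e, he, heJ, hf', -⟩ := Deflation.exists_shorter_of_pair β cstar nstar hadm ({t₁, t₂, s} : Finset ι)
    (fun i hi => by
      simp only [Finset.mem_insert, Finset.mem_singleton] at hi
      rcases hi with rfl | rfl | rfl
      · exact Or.inl ⟨η₁, hG _ η₁ hη₁⟩
      · exact Or.inl ⟨η₂, hG _ η₂ hη₂⟩
      · exact Or.inr ⟨ω, fun p j => by rw [hω p, Pi.smul_apply, smul_eq_mul]⟩)
  exact ⟨β', e, he, heJ, hf'⟩

end LShapeKill

end Summit.MatrixMultiplication.OmegaCensus.SmallFormats
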